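import Summits.CriticalPhenomena.PercolationContinuityZ3.Theorems.PercNearOneGluingNoHeavyPcintNawFreeZ6F10Check1
import Summits.CriticalPhenomena.PercolationContinuityZ3.Theorems.PercNearOneGluingNoHeavyPcintNawFreeZ6F10Check2
import Summits.CriticalPhenomena.PercolationContinuityZ3.Theorems.PercNearOneGluingNoHeavyPcintNawFreeZ6F10Check3
import Summits.CriticalPhenomena.PercolationContinuityZ3.Theorems.PercNearOneGluingNoHeavyPcintNawFreeZ6F10Check4
import HarnessLib

/-!
# PCINT lane, kernel reduced-state B2d (`nawfree`) certificate `Z6F10` (d = 6, memory τ = 10, delay kt = 4, 798 state classes): the theorem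

Cell `prim-pcint`, seat `prim-pcint-1` (gen 6); memo `run/shared/lean/prim/pcint/REDUCTIONS.md` §B2d (delayed chain payments with
free-neighbour shares).  Does NOT build on p205010.  Data for `NawK.le_siteCriticalProb_of_checkRowsF` (`…PcintNawFreeMemKernelCert`):
`p = 10110/100000`, weight table `Q_k/100000`, `Q = [89890, 89890, 94811, 96510, 97371, 97891, 98240, 98489, 98677, 98823, 98940, 99036, 99116]` (`Q_k^k·100000 ≥ (100000-10110)·100000^k`, nondecreasing), `λ = 99999/100000`; Collatz–Wielandt
weights (scale 10⁹) from a power iteration, exact off-line max row ratio 0.9998424171 < λ.  Generated by work/gen6/gen_free.py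
(pcint-1 gen 6 folder); the kernel re-checks every row.
-/

namespace Summit.CriticalPhenomena.PercolationContinuityZ3.Theorems.Pcint

open Literature.Probability.Percolation Literature.Probability.LatticeModels

/-- Every row of the certificate passes. [folklore] -/
theorem NawFreeZ6F10.all_rows : WinK.allRange (NawK.checkRowF 10 4 6 798 10110 100000 99999 100000 NawFreeZ6F10.QL NawFreeZ6F10.syms NawFreeZ6F10.tree) 0 798 = true := (WinK.allRange_split (WinK.allRange_split (WinK.allRange_split NawFreeZ6F10.file_1 NawFreeZ6F10.file_2) NawFreeZ6F10.file_3) NawFreeZ6F10.file_4)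


/-- **`p_c^site(ℤ^6) ≥ 0.1011`** (kernel-checked reduced-state B2d certificate: delayed chain payments with free-neighbour shares on the
memory-`10` dangerous-set automaton, delay kt = 4, 798 state classes, `decide +kernel` only). [folklore] -/
theorem siteCriticalProb_Z6_ge_01011_free : (0.1011 : ℝ) ≤ siteCriticalProb (zdGraph 6) 0 := by
  have h := NawK.le_siteCriticalProb_of_checkRowsF (d := 6) (τ := 10) (kt := 4) (N := 798) (pn := 10110) (D := 100000)
    (lamN := 99999) (lamD := 100000) (QL := NawFreeZ6F10.QL) (syms := NawFreeZ6F10.syms) (t := NawFreeZ6F10.tree)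
    (by norm_num) (by norm_num) (by norm_num)
    (fun c => NawK.symOfTab 6 (NawFreeZ6F10.syms.getD c [])) (NawK.syms_spec_of_valid NawFreeZ6F10.syms_valid)
    (fun i hi => WinK.of_allRange NawFreeZ6F10.all_rows (Nat.zero_le i) hi)
    (by norm_num) (by decide +kernel) (by norm_num) (by norm_num) (by decide +kernel) (by norm_num)
  have e : ((10110 : ℕ) : ℝ) / ((100000 : ℕ) : ℝ) = (0.1011 : ℝ) := by norm_num
  rw [e] at h
  exact h

end Summit.CriticalPhenomena.PercolationContinuityZ3.Theorems.Pcint
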